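import Mathlib
import Literature.Analysis.FluidPDE.HardSphereCollisionRecord
import Literature.Analysis.FluidPDE.LocalForecastCorrector
import Literature.MathematicalPhysics.KineticTheory.HardSphereEuler

/-!
# Crux-ideate sketch — `ClampedTransferWindowLD` (stmt-AtomisticToContinuum-16623), round 1, ideator 2

First lemmas / typed cores of the two crux idea cards of this seat (they only need to ELABORATE;
nothing here is proved).  All objects are the crux's own (`HardSphereFlow.collisionSum`, transfer
activity `(σ/τ)Σ(‖Δv‖ + |Δ‖v‖²|/2)`, pair-symmetric clamp `ω_fst ω_snd`, momentum mark
`(φ(x_fst) − φ(x_snd))(v_fst⁺ − v_fst⁻)_k / 2`), written once for a GENERAL hard-sphere flow so that the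
same definitions serve the torus system, its `R`-local forecast clusters
(`Literature/Analysis/FluidPDE/LocalForecastCorrector.lean`: `rangeCluster`, `Config.restrictTo`,
`clusterIndex`, `clusterStateIn`) and the Euclidean cell systems of the N-free core.

Card B `clamp-price-static-shell` (the one card filed by this seat):
* `IsolatedShellDomination` — FIRST LEMMA (pathwise): isolated-binary transfer impulses of the tagged particle
  are dominated by the window integral of the static near-contact shell functional `shellRate`.
* `StaticTransferActivityTail` — τ-UNIFORM static tail (provable now from the tree's collision-flux bound).
* `TaggedShellRateCesaroDecay` — the variance-level rung the fixed-V price reduces to (Cesàro decay of ONE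
  static autocovariance along the tagged orbit; species of IPE CollisionRate's open `(PM|const)`).
* `TaggedTransferActivityTail` — the clamp's dynamical price (F2) typed, probability level.
* `ActivityLocality` — the activity is own-path-determined, so FIRST-moment influence locality (13916 restated)
  transfers F2 to a local / infinite-volume statement (no hyperactive invariant components).

Recorded dead line (explored, NOT filed): exponential-moment localisation of C′ (`ClampLocality` is its true
pathwise lemma; the LD locality input it needs is false for long horizons — see the section docstring).
-/

namespace Summit.AtomisticToContinuum.HydrodynamicLimit.Cruxes.ClampedTransferWindowLD.IdeatorTwo

open MeasureTheory
open scoped Classical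
open Literature.Analysis.FluidPDE Literature.MathematicalPhysics.KineticTheory

noncomputable section

/-! ## Generic clamped-transfer vocabulary for a hard-sphere flow of `M` spheres -/

section Generic

variable {X : Type*} [MeasureSpace X] [TopologicalSpace X] {G : Geometry (Fin 3) X} {ε : ℝ} {M : ℕ}

/-- Transfer impulse of the FIRST particle of a record: momentum + energy impulse
`‖v⁺ − v⁻‖ + |‖v⁺‖² − ‖v⁻‖²|/2` (the crux's activity summand). -/
def impulse (c : HardSphereCollisionRecord (Fin 3) X M) : ℝ :=
  ‖c.postVel.1 - c.preVel.1‖ + |‖c.postVel.1‖ ^ 2 - ‖c.preVel.1‖ ^ 2| / 2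

/-- Window transfer activity of particle `m` along the flow `Ψ`, normalised by `κ` (`κ = σ/τ = ε_N/w`
on the torus, `κ = σ/T` in cell units): `κ · Σ_{records in (0,w], fst = m} impulse`. -/
def actOf (Ψ : HardSphereFlow G ε M) (κ w : ℝ) (m : Fin M) (y : Config M (Fin 3) X) : ℝ :=
  κ * Ψ.collisionSum (Set.Ioc 0 w) (fun c => if c.fst = m then impulse c else 0) y

/-- The (anticipating, window-global) transfer clamp `ω_m = 1{act_m ≤ V}`. -/
def flagOf (Ψ : HardSphereFlow G ε M) (κ w V : ℝ) (m : Fin M) (y : Config M (Fin 3) X) : ℝ :=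
  if actOf Ψ κ w m y ≤ V then 1 else 0

/-- OWN clamped payload of particle `m`: the pair-symmetrically clamped sum over its records (as
`fst`) of `mark / 2` — so that the crux's row is `Σ_m payloadOf` (split of the record sum by `fst`). -/
def payloadOf (Ψ : HardSphereFlow G ε M) (κ w V : ℝ) (mark : HardSphereCollisionRecord (Fin 3) X M → ℝ)
    (m : Fin M) (y : Config M (Fin 3) X) : ℝ :=
  Ψ.collisionSum (Set.Ioc 0 w)
    (fun c => if c.fst = m then flagOf Ψ κ w V c.fst y * flagOf Ψ κ w V c.snd y * mark c / 2 else 0) y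

variable {N : ℕ}

/-- FORECAST payload of particle `i` of an `N`-sphere system: its own clamped payload computed
ENTIRELY inside the isolated run (cluster flow `Ψs k`) of its range-`R` cluster — records, marks and
BOTH clamps read in that run.  An `R`-local function of the datum `z`. -/
def fcPayloadOf (G : Geometry (Fin 3) X) (Ψs : (k : ℕ) → HardSphereFlow G ε k) (R κ w V : ℝ)
    (mark : (k : ℕ) → HardSphereCollisionRecord (Fin 3) X k → ℝ) (z : Config N (Fin 3) X)
    (i : Fin N) : ℝ :=
  payloadOf (Ψs (rangeCluster G R z i).card) κ w V (mark (rangeCluster G R z i).card)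
    (clusterIndex (rangeCluster G R z i) i (self_mem_rangeCluster G R z i))
    (Config.restrictTo (rangeCluster G R z i) z)

/-- The GOOD event of card A for particle `i`: the isolated run of its range-`R` cluster reproduces, on
`[0, w]`, the true path of every particle that comes within `r` of `i` (in particular `i` itself and
all its collision partners, `r ≥ ε`).  On it the forecast payload of `i` equals its true payload. -/
def ReproducesNear (Φ : HardSphereFlow G ε N) (Ψs : (k : ℕ) → HardSphereFlow G ε k) (R w r : ℝ)
    (z : Config N (Fin 3) X) (i : Fin N) : Prop :=
  ∀ j : Fin N, (∃ t ∈ Set.Icc 0 w, ‖G.sepVec (Φ.flow t z i).1 (Φ.flow t z j).1‖ ≤ r) →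
    ∃ hj : j ∈ rangeCluster G R z i,
      ∀ t ∈ Set.Icc 0 w, Φ.flow t z j = clusterStateIn Ψs (rangeCluster G R z i)
        (clusterIndex (rangeCluster G R z i) j hj) t z

end Generic

/-! ## Recorded dead line (explored as "card A", NOT filed): exponential-moment localisation of C′

`ClampLocality` below is TRUE (pathwise) and is what made the line look attractive: the transfer clamp
bounds every particle's own clamped payload by `½ L V w`, so truth and range-`R` forecast differ by at most
`L V w` per non-reproduced particle.  The line is nevertheless DEAD for this crux: it needs the
non-reproduced COUNT in exponential moments at the fixed amplitude `lam = |β| L V` over horizons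
`T = τ → ∞`, and the standing disprover of `AntiMazurCoboundaries.InfluenceLocality` (stmt-13916,
`Cruxes/InfluenceLocality/Disproof.lean` header 4, `RETYPE.md` §1, `SteeredDispersalCascades.md`) shows the
exponential-moment light cone fails above `lam**(T) ≍ λ_mf²/(θT²) → 0` (steered dispersal cascades corrupt
forecasts at a cost per forecast BOUNDED in `R`); only the FIRST-MOMENT form survives (proved modulo `G_free`).
Bounding the charge per corrupted particle by its activity (`≤ L·act_i ≍ L σ³ θ`) instead of `L V` does not
help: the amplitude stays fixed while `lam** → 0`.  Kept here as negative knowledge for the crux; the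
first-moment locality IS used by card B (`ActivityLocality`), because the clamp's price is probability-level. -/

/-- The torus momentum mark of row `k` for the test function `φ` (the crux's summand without clamps). -/
def torusMark (φ : T3 → ℝ) (k : Fin 3) (M : ℕ) (c : HardSphereCollisionRecord (Fin 3) T3 M) : ℝ :=
  (φ c.fstPos - φ c.sndPos) * (c.postVel.1 k - c.preVel.1 k)

/-- **Card A, first lemma (pathwise clamp locality).**  For an `L`-Lipschitz test function (minimal-image
distance), on a good datum whose range clusters are good data of the cluster flows, the true clamped
momentum transfer of row `k` (the crux's `Xm k`, split by `fst`) and its range-`R` FORECAST version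
differ by at most `L · V · w` per particle whose contact neighbourhood (`r = 2 ε_N`) is not reproduced by
its own cluster run: contact ⇒ `|φ(x_fst) − φ(x_snd)| ≤ L ε_N`, a retained particle carries impulse
`≤ V τ/σ`, `ε_N τ/σ = w`; reproduced particles have identical own records, marks and partner clamps. -/
def ClampLocality : Prop :=
  ∀ (σ τ V R : ℝ) (N : ℕ), 0 < σ → 0 < τ → 0 ≤ V → hsDiameter σ N < 2⁻¹ →
  ∀ (Φ : HardSphereFlow (Torus.geometry (Fin 3)) (hsDiameter σ N) (N + 1))
    (Ψs : (k : ℕ) → HardSphereFlow (Torus.geometry (Fin 3)) (hsDiameter σ N) k)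
    (φ : T3 → ℝ) (L : ℝ), (∀ x y, |φ x - φ y| ≤ L * Torus.euclidDist x y) →
  ∀ (k : Fin 3) (z : Config (N + 1) (Fin 3) T3), z ∈ Φ.good →
    (∀ i, Config.restrictTo (rangeCluster (Torus.geometry (Fin 3)) R z i) z ∈
      (Ψs (rangeCluster (Torus.geometry (Fin 3)) R z i).card).good) →
    (let w : ℝ := τ * ((N : ℝ) + 1) ^ (-(1 / 3 : ℝ))
     |∑ i : Fin (N + 1), payloadOf Φ (σ / τ) w V (torusMark φ k (N + 1)) i z
        - ∑ i : Fin (N + 1), fcPayloadOf (Torus.geometry (Fin 3)) Ψs R (σ / τ) w V (torusMark φ k) z i|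
      ≤ L * V * w * ((Finset.univ.filter fun i : Fin (N + 1) =>
          ¬ ReproducesNear Φ Ψs R w (2 * hsDiameter σ N) z i).card : ℝ))

/-- **Card B, first-moment locality of the ACTIVITY (pathwise congruence).**  The window transfer activity
of particle `i` is a function of `i`'s OWN path (its velocity jumps), so it coincides with the activity read in
the isolated run of `i`'s range cluster whenever that run reproduces `i`'s path on `[0, w]` — the badness notion
of stmt-13916 VERBATIM (`Φ_t z i ≠ localClusterState …`).  Hence `|G_N(act₀ > V) − G_N(act₀^{fc} > V)| ≤
E_G #bad/(N+1)` (exchangeability), and the restated FIRST-MOMENT `InfluenceLocality` (proved modulo `G_free`,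
`Theorems/AntiMazurCoboundariesInfluenceLocalityFirstMoment`) transfers the probability-level price (F2) — and
only it — to a local / infinite-volume statement. -/
def ActivityLocality : Prop :=
  ∀ (σ τ R : ℝ) (N : ℕ), 0 < σ → 0 < τ → hsDiameter σ N < 2⁻¹ →
  ∀ (Φ : HardSphereFlow (Torus.geometry (Fin 3)) (hsDiameter σ N) (N + 1))
    (Ψs : (k : ℕ) → HardSphereFlow (Torus.geometry (Fin 3)) (hsDiameter σ N) k)
    (i : Fin (N + 1)) (z : Config (N + 1) (Fin 3) T3), z ∈ Φ.good →
    Config.restrictTo (rangeCluster (Torus.geometry (Fin 3)) R z i) z ∈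
      (Ψs (rangeCluster (Torus.geometry (Fin 3)) R z i).card).good →
    (let w : ℝ := τ * ((N : ℝ) + 1) ^ (-(1 / 3 : ℝ))
     (∀ t ∈ Set.Icc 0 w, Φ.flow t z i = localClusterState Ψs R t z i) →
     actOf Φ (σ / τ) w i z =
       actOf (Ψs (rangeCluster (Torus.geometry (Fin 3)) R z i).card) (σ / τ) w
         (clusterIndex (rangeCluster (Torus.geometry (Fin 3)) R z i) i
           (self_mem_rangeCluster (Torus.geometry (Fin 3)) R z i))
         (Config.restrictTo (rangeCluster (Torus.geometry (Fin 3)) R z i) z))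

/-! ## Card B — the clamp's price is variance-level -/

/-- **Card B, the clamp's dynamical price TYPED (F2, weakest sufficient form).**  Frame of the crux; the
transfer activity of the tagged particle `0` over the window exceeds `V ≥ V₀` with probability `→ 0` as
`τ → ∞`, uniformly in `N` (probability level — this, not an exponential moment, is what the clamp-deficit
linear residual of C′ consumes).  = the untyped `TaggedTransferActivityLLN` of both registered lines. -/
def TaggedTransferActivityTail : Prop :=
  ∃ σ₀ : ℝ, 0 < σ₀ ∧ ∀ (a₀ θ₀ : ℝ) (u₀ : V3), 0 < a₀ → 0 < θ₀ → ∀ σ : ℝ, 0 < σ → σ < σ₀ →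
  ∀ Φ : (N : ℕ) → HardSphereFlow (Torus.geometry (Fin 3)) (hsDiameter σ N) (N + 1),
  ∃ V₀ : ℝ, 0 < V₀ ∧ ∀ V : ℝ, V₀ ≤ V → ∀ ε : ℝ, 0 < ε → ∃ τ₀ : ℝ, 0 < τ₀ ∧ ∀ τ : ℝ, τ₀ ≤ τ →
  ∃ N₀ : ℕ, ∀ N : ℕ, N₀ ≤ N →
    (let w : ℝ := τ * ((N : ℝ) + 1) ^ (-(1 / 3 : ℝ))
     let P := localGibbsLaw σ (fun _ => a₀) (fun _ => u₀) (fun _ => θ₀) N (Φ N)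
     P {z | V < actOf (Φ N) (σ / τ) w (0 : Fin (N + 1)) z} ≤ ENNReal.ofReal ε)

/-- **Card B, static half (τ-UNIFORM first-moment tail; provable now).**  Markov + the tree's N-uniform
collision-flux bound for nonnegative velocity marks under the invariant Gibbs law
(`localGibbsLaw_collisionMarkSum_ge_le`, CIP 1994 App. 4.A): `E_G[act₀] ≤ C σ³` uniformly in `τ` and
`N`, hence the tail `≤ C σ³ / V` — small for large `V` but NOT decaying in `τ` (the clamp's τ-content is
exactly what this bound cannot see). -/
def StaticTransferActivityTail : Prop :=
  ∀ (a₀ θ₀ : ℝ) (u₀ : V3), 0 < a₀ → 0 < θ₀ → ∃ C : ℝ, 0 < C ∧ ∃ σ₁ : ℝ, 0 < σ₁ ∧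
  ∀ σ : ℝ, 0 < σ → σ < σ₁ →
  ∀ Φ : (N : ℕ) → HardSphereFlow (Torus.geometry (Fin 3)) (hsDiameter σ N) (N + 1),
  ∀ τ : ℝ, 0 < τ → ∀ N : ℕ, 1 ≤ N → ∀ V : ℝ, 0 < V →
    (let w : ℝ := τ * ((N : ℝ) + 1) ^ (-(1 / 3 : ℝ))
     let P := localGibbsLaw σ (fun _ => a₀) (fun _ => u₀) (fun _ => θ₀) N (Φ N)
     P {z | V < actOf (Φ N) (σ / τ) w (0 : Fin (N + 1)) z} ≤ ENNReal.ofReal (C * σ ^ 3 / V))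

/-- The static SHELL-RATE functional of the tagged particle `0`: `Σ_{j ≠ 0, ε_N < d(x₀,x_j) < 2ε_N}
‖v₀ − v_j‖² (1 + ‖v₀ + v_j‖/2)` — its window average dominates pathwise (`× σ/(τ ε_N) · w = 1`) the
transfer activity carried by ISOLATED binary collisions (free inbound leg across the shell `[ε_N, 2ε_N]`,
duration `≥ ε_N/‖g‖`), and all its static POLYNOMIAL moments are explicit (Maxwellian, Ruelle bound; it is cubic in the
velocities through the energy impulse, so exponential moments are NOT available — and not needed at probability level). -/
def shellRate (σ : ℝ) (N : ℕ) (z : Config (N + 1) (Fin 3) T3) : ℝ :=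
  ∑ j : Fin (N + 1), if j ≠ 0 ∧ hsDiameter σ N < Torus.euclidDist (z 0).1 (z j).1 ∧
      Torus.euclidDist (z 0).1 (z j).1 < 2 * hsDiameter σ N
    then ‖(z 0).2 - (z j).2‖ ^ 2 * (1 + ‖(z 0).2 + (z j).2‖ / 2) else 0

/-- The ISOLATED-BINARY part of the tagged transfer activity: records of particle `0` in `(0, w]` whose
inbound leg fits in the window (`2ε_N ≤ ‖g‖ t_c`, `g` the incoming relative velocity) and during whose leg
window `[t_c − 2ε_N/‖g‖, t_c]` no third particle comes within `3ε_N` of either partner.  These records have a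
FREE inbound leg across the shell `[ε_N, 2ε_N]` of duration `≥ ε_N/‖g‖`; the others (crowded bursts — the
Newton cradle of the 13733 Disproof is the extreme case: zero legs — and the slow/early edge) are NOT dominated
by any static time integral and are booked separately (mean `O(σ³)` of the total by the flux bound). -/
def isoAct (σ τ : ℝ) (N : ℕ) (Φ : HardSphereFlow (Torus.geometry (Fin 3)) (hsDiameter σ N) (N + 1))
    (z : Config (N + 1) (Fin 3) T3) : ℝ :=
  let ε : ℝ := hsDiameter σ N
  let w : ℝ := τ * ((N : ℝ) + 1) ^ (-(1 / 3 : ℝ))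
  σ / τ * Φ.collisionSum (Set.Ioc 0 w) (fun c =>
    if c.fst = 0 ∧ 2 * ε ≤ ‖c.preVel.1 - c.preVel.2‖ * c.time ∧
        (∀ k : Fin (N + 1), k ≠ 0 → k ≠ c.snd →
          ∀ t ∈ Set.Icc (c.time - 2 * ε / ‖c.preVel.1 - c.preVel.2‖) c.time,
            3 * ε < Torus.euclidDist (Φ.flow t z k).1 (Φ.flow t z 0).1 ∧
            3 * ε < Torus.euclidDist (Φ.flow t z k).1 (Φ.flow t z c.snd).1)
    then impulse c else 0) z

/-- **Card B, first lemma `IsolatedShellDomination` (pathwise, provable now).**  On a good orbit the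
isolated-binary transfer activity of the tagged particle is at most the WINDOW AVERAGE of the static shell rate:
per isolated record `ε_N · (‖Δv‖ + |Δ‖v‖²|/2) ≤ ε_N ‖g‖ (1 + ‖V_cm‖) ≤ ∫_leg ‖g‖²(1 + ‖v₀ + v_j‖/2) dt`
(free leg, radial distance `ε_N` at radial speed `≤ ‖g‖`, `Δ‖v₀‖²/2 = Δv·V_cm`), legs of distinct isolated
records are disjoint and lie in `(0, w]`, extra shell terms are `≥ 0`, and `(σ/τ)/ε_N = w⁻¹`.  This is the
bridge that turns the collision-indexed, history-dependent clamp price into a statement about a phase-space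
observable along the flow (Jensen in time, static pressures, autocovariances then apply). -/
def IsolatedShellDomination : Prop :=
  ∀ (σ τ : ℝ) (N : ℕ), 0 < σ → 0 < τ → hsDiameter σ N < 8⁻¹ →
  ∀ (Φ : HardSphereFlow (Torus.geometry (Fin 3)) (hsDiameter σ N) (N + 1))
    (z : Config (N + 1) (Fin 3) T3), z ∈ Φ.good →
    (let w : ℝ := τ * ((N : ℝ) + 1) ^ (-(1 / 3 : ℝ))
     isoAct σ τ N Φ z ≤ w⁻¹ * ∫ t in (0 : ℝ)..w, shellRate σ N (Φ.flow t z))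

/-- **Card B, the variance-level rung `TaggedShellRateCesaroDecay`.**  Under the invariant Gibbs law the
window average of the tagged shell rate has variance `→ 0` as `τ → ∞`, uniformly in `N` — i.e. Cesàro
decay of ONE explicit nonnegative static functional's tagged autocovariance (`Var(avg) =
(2/w²)∫₀ʷ (w − s) Cov_G(q, q∘Φ_s) ds`).  With the static tails it gives `TaggedTransferActivityTail` for
the isolated-binary part of the activity (Chebyshev); the crowded part is the same statement one
cluster-order down.  The N-uniform SECOND moment at a fixed short window is already the open
`(PM|const)` of `Theorems/InformationPercolationEngineCollisionRateWindowCountSquareTightConst`. -/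
def TaggedShellRateCesaroDecay : Prop :=
  ∃ σ₀ : ℝ, 0 < σ₀ ∧ ∀ (a₀ θ₀ : ℝ) (u₀ : V3), 0 < a₀ → 0 < θ₀ → ∀ σ : ℝ, 0 < σ → σ < σ₀ →
  ∀ Φ : (N : ℕ) → HardSphereFlow (Torus.geometry (Fin 3)) (hsDiameter σ N) (N + 1),
  ∀ ε : ℝ, 0 < ε → ∃ τ₀ : ℝ, 0 < τ₀ ∧ ∀ τ : ℝ, τ₀ ≤ τ → ∃ N₀ : ℕ, ∀ N : ℕ, N₀ ≤ N →
    (let w : ℝ := τ * ((N : ℝ) + 1) ^ (-(1 / 3 : ℝ))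
     let P := localGibbsLaw σ (fun _ => a₀) (fun _ => u₀) (fun _ => θ₀) N (Φ N)
     ∫⁻ z, ENNReal.ofReal ((w⁻¹ * ∫ r in (0 : ℝ)..w, shellRate σ N ((Φ N).flow r z)
            - ∫ y, shellRate σ N y ∂P) ^ 2) ∂P ≤ ENNReal.ofReal ε)

end

end Summit.AtomisticToContinuum.HydrodynamicLimit.Cruxes.ClampedTransferWindowLD.IdeatorTwo
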